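import Literature.AnabelianGeometry.EtaleTheta.Discharge.Sec5RootCompositionModel
import Literature.AnabelianGeometry.EtaleTheta.Discharge.Sec4Prop42SubRootCoverLaws

/-!
# [EtTh] Rmk. 4.3.2 / Prop. 5.2 (i) at the canonical model: an `N`-th root OVER THE DOMAIN OF A GIVEN ROOT,
# with its covering chosen at a multiple level — GAP row G-L2t4-1b discharged for a constructed root

(module docstring continues below the imports; see `## What is proved`.)
-/

/-!
Mochizuki, *The étale theta function and its Frobenioid-theoretic manifestations*, Publ. RIMS **45** (2009):
Rmk. 4.3.2 pp. 318–319 (PDF pp. 92–93) «if `N` divides `N′` … there exists a "morphism" from a suitable `N′`-th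
root of the fraction-pair `(s′, s″)` to the given `N`-th root … such a "morphism" may be constructed by
extracting an "`N′/N`-th root" [cf. Proposition 4.2, (iii)] of the [fraction-pair determined by the] given
"`N`-th root"»; Prop. 5.2 (i) p. 324 (PDF p. 98) «… constitutes an `l·N`-th root of a right fraction-pair … of …
`Θ̈` …, or, alternatively, an `N`-th root of a right fraction-pair … of … an `l`-th root of … `Θ̈` [cf. Remark
4.3.2]», proof: «the "(l·N, H_⊙, f|_{A_{l·N}})-saturated-ness" condition of Proposition 4.2, (iii), follows
immediately from the definition of the field `J̈_{l·N}` in §1» [cite: MochizukiEtTh2009, Rmk 4.3.2 p.318 (PDF p.92)].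

abc-iut cell, layer L2, PROOF-ONLY companion (0 `def`s; seat abc-iut-w5-d134 gen 4) of abc-iut-L2-t3's
`BiKummerRoots.lean`, abc-iut-L2-t9's `BiKummerOfModelCanonical.lean`, this lineage's `Prop42Sub.lean` /
`Sec5RootCompositionModel.lean` and abc-iut-w4-d044's `Sec4Prop42SubRootCoverLaws.lean` /
`Sec4Prop42SubRefinement.lean`; GAP-LEDGER rows G-L2t4-1 / G-L2t4-1b (the level-`l·N` clauses `hμ`, `hcondA`
on the `N`-domain of the composite root) and abc-iut-L2-t4's «NEXT (2): roots `Rl` / `R`» (HANDOFF block #2).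
Nothing landed is edited or restated.

## What is proved

Print's Prop. 4.2 (iii) is stated for `f ∈ O^×(A_⊙^birat)` — the typed `BiKummerSetting.Prop42_iii` and every
sub-row of plan/L2/SUBDAG-EtTh-Prop42.md accordingly pin the domain to `A_⊙` — but Rmk. 4.3.2 (and through it
Prop. 5.2 (i), second alternative) APPLIES it to the fraction-pair on the `N`-domain `A_N` of a given root, a
Frobenius-trivial Galois `H_⊙`-ample object other than `A_⊙`, the group `H_⊙` being unchanged.  abc-iut-L2-t4's
§5 carrier (`ThetaFrobenioid.ofBiKummerData` / `ofConnectedTemperoidData`) is built on exactly such a datum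
`R : S.NthRoot Rl.root Rl.pair N` over the `l`-domain `A_l := Rl.AN` of an `l`-th root `Rl` of `Θ̈`'s pair,
which so far had no producer in the tree.  At the canonical model instance
`S := mkOfModelCanonical X tf … A₀ …` with the model transport `pullFracModel` we prove:

* `exists_nthRoot_twoLevel_mkOfModelCanonical` — **Prop. 4.2 (iii) over a general domain, with the covering
  chosen at a multiple level**: for a Frobenius-trivial object `A` with Galois base lying in a skeleton through
  `A_⊙`, `f ∈ O^×(A^birat)` FIXED BY `H_A`, a right fraction-pair `P` of `f` and `N ∣ M`, there is an `N`-th root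
  `R` of `P` whose `N`-domain lies in a skeleton through `A_⊙`, is `μ_M`-saturated and satisfies condition (a)
  of Def. 4.1 (iii) at level `M` — modulo the base-level laws of abc-iut-w4-d044's closers taken verbatim (`Φ`
  divisorial, the [FrdI] Prop. 4.1 (iii) coprimality-pull-back law `hDSpull`, the ERRATUM-E2 root law `hR`
  (G-w4d044-3), the Def. 4.1 (ii) naturality law `hS`) and the [FrdII] Rmk. 2.2.1 refinement law at the TWO
  levels `N ∣ M` jointly (`hE₂`: a `μ_M`-saturated Galois pull-back cover `(M, H_⊙^{bs-fld})`- and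
  `(N, H_⊙^{bs-fld})`-saturated — G-w4d044-2's `hE` at two levels; print: the field `J̈_{l·N}`).
  METHOD: L01a over `A` (`exists_isPullback_over_baseHom` is generic in the object) → two-level refinement →
  normalisation into the skeletons through `A_⊙` AND `A` ([FrdI] Thm. 5.1 (iii) base-triviality,
  `exists_iso_baseMap_eq_of_isFrobeniusTrivial`) → `H_{A_N}`-fixedness of `f|_{A_N}` from the `H_A`-fixedness of
  `f`, the `H_⊙`-ampleness of `A` and `hS` (`isFixedByHA_pullFracModel`) → the rows L02 `RootFractionPair`, L03′
  `BaseFrobeniusLiftUpToUnit`, L04 `RootSquares` TRANSPORTED from the instance `mkOfModelCanonical … (A₀ := A) …`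
  (same tempered Frobenioid: fraction-pairs and base-Frobenius-type data are carried field by field; only the
  `(N, H_⊙, ·)`-saturation, which sees `H_⊙`, is built in `S` itself) → `μ_M ⇒ μ_N` (`IsMuSaturated.of_dvd`).
The companion `Discharge/Sec5RootOfRootModelComp.lean` specialises to `A := Rl.AN`, `f := Rl.root` for an `l`-th
root `Rl` of `Θ̈`'s pair (the G-L2t4-1b clauses `hμ`, `hcondA` and the skeleton clause `hsk` become theorems about
the constructed `R`) and derives [EtTh] Prop. 5.2 (i) in BOTH printed alternatives for the constructed pair.

HONEST FRAMING: kernel-checked consequences of the named base-level laws for data so typed; nothing asserts that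
such data exist for an actual curve; [EtTh] is a refereed prerequisite paper; no side is taken on [IUTchIII]
Cor. 3.12; typed ≠ proved for the laws.
-/

noncomputable section

namespace Literature.AnabelianGeometry.EtaleTheta

open CategoryTheory Opposite Literature.AlgebraicGeometry.Frobenioids

universe u₀ v₀ u v w

/-! ### `μ_M`-saturation implies `μ_N`-saturation for `N ∣ M` -/

namespace TemperedFrobenioid

variable {D₀ : Type u₀} [Category.{v₀} D₀] {V : FrdIMonoidStub.{w}} {T : RealifiedDivisorMonoids (D₀ := D₀) V}
  {D : Type u} [Category.{v} D] {VD : FrdICatStub.{u, v, w} D} {C : TemperedFrobenioid T D VD}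

/-- **[FrdII] Def. 2.1 (i) at two levels**: if `μ_M(A) ≅ ℤ/Mℤ` (generated by a unit `σ` of order `M`) and
`N ∣ M`, then `μ_N(A) ≅ ℤ/Nℤ`, generated by `σ^{M/N}` — every `N`-torsion unit is `M`-torsion, hence a power
`σ^i` with `M ∣ i·N`.  [cite: MochizukiEtTh2009, Def 4.1 (iv) p.313 (PDF p.87)] -/
theorem IsMuSaturated.of_dvd {A : C.category} {N M : ℕ+} (h : C.IsMuSaturated A M) (hNM : (N : ℕ) ∣ (M : ℕ)) :
    C.IsMuSaturated A N := by
  obtain ⟨k, hk⟩ := hNM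
  obtain ⟨σ, ⟨hσu, hσM⟩, hord, hgen⟩ := h
  have hk0 : k ≠ 0 := by
    rintro rfl
    exact PNat.ne_zero M (by rw [hk, mul_zero])
  have hkdvd : k ∣ orderOf σ := by
    rw [hord, hk]
    exact Dvd.intro_left _ rfl
  refine ⟨σ ^ k, ⟨(C.units A).pow_mem hσu k, ?_⟩, ?_, ?_⟩
  · rw [← pow_mul, mul_comm, ← hk]
    exact hσM
  · rw [orderOf_pow_of_dvd hk0 hkdvd, hord, hk, Nat.mul_div_cancel _ (Nat.pos_of_ne_zero hk0)]
  · rintro τ ⟨hτu, hτN⟩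
    have hτM : τ ^ (M : ℕ) = 1 := by rw [hk, pow_mul, hτN, one_pow]
    obtain ⟨i, hi⟩ := Subgroup.mem_zpowers_iff.1 (hgen τ ⟨hτu, hτM⟩)
    have hdiv : ((k : ℤ) * N) ∣ i * N := by
      have hM : (orderOf σ : ℤ) ∣ i * N := by
        apply orderOf_dvd_iff_zpow_eq_one.2
        rw [zpow_mul, hi, zpow_natCast, hτN]
      rw [hord, hk, Nat.cast_mul, mul_comm] at hM
      exact hM
    obtain ⟨j, hj⟩ := (mul_dvd_mul_iff_right (by exact_mod_cast PNat.ne_zero N)).1 hdiv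
    exact Subgroup.mem_zpowers_iff.2 ⟨j, by rw [← zpow_natCast, ← zpow_mul, ← hj, hi]⟩

end TemperedFrobenioid

namespace BiKummerSetting

/-! ### At the canonical model `mkOfModelCanonical` -/

section Canonical

variable {K : Type u₀} [Field K] (X : SemiGraphs.TemperedArithmeticGroup.{u₀} K) {D₀ : Type u₀}
  [Category.{v₀} D₀] {V : FrdIMonoidStub.{w}} {T : RealifiedDivisorMonoids (D₀ := D₀) V}
  {D : Type u} [Category.{v} D] {VD : FrdICatStub.{u, v, w} D}
  (tf : TemperedFrobenioid T D VD) (hZ : tf.monoidType = MonoidType.Z)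
  (hP : ∀ A : Dᵒᵖ, IsPerfect (tf.Φ.carrier A)) (IG : D → Prop) (gS : ∀ A : D, IG A → (X.Pi →* Aut A))
  (gSs : ∀ (A : D) (h : IG A), Function.Surjective (gS A h))
  (NH : Subgroup (Field.absoluteGaloisGroup K) → tf.category → ℕ+ → Prop) (A₀ : tf.category)
  (hA₀ : PreFrobenioid.IsFrobeniusTrivial tf.toElem A₀) (hA₀' : IG A₀.base)
  (hΦd : Objectwise (fun M _ => IsDivisorial M) tf.divisorMonoid)

/-- **Naturality of the Galois surjections, read on an element of `H_{A_N}`** (Def. 4.1 (ii), outer form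
`hS`): for Galois `A_N`, `σ ∈ H_{A_N}` (so `Base(σ⁻¹) = ρ_{A_N^bs}(h)` with `h ∈ H_⊙`) and any base morphism
`b : A_N^bs → A^bs` to a Galois `A^bs`, one has `Base(σ⁻¹) ≫ b = b ≫ ρ_{A^bs}(h′)` for some `h′ ∈ H_⊙` (a
conjugate of `h`; `H_⊙ = Ker(Π^tp_X ↠ Aut(A_⊙^bs))` is normal).  [cite: MochizukiEtTh2009, Def 4.1 (ii) p.313 (PDF p.87)] -/
theorem exists_baseMap_inv_comp_eq_of_mem_HA
    (hS : ∀ ⦃A B : D⦄ (hA : IG A) (hB : IG B) (b : B ⟶ A),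
      ∃ c : X.Pi, ∀ g : X.Pi, (gS B hB g).hom ≫ b = b ≫ (gS A hA (c * g * c⁻¹)).hom)
    {AN A : tf.category} (hAN : IG AN.base) (hA : IG A.base) (b : AN.base ⟶ A.base) {σ : Aut AN}
    (hσ : σ ∈ (mkOfModelCanonical X tf hZ hP IG gS gSs NH A₀ hA₀ hA₀').HA AN hAN) :
    ∃ h ∈ (mkOfModelCanonical X tf hZ hP IG gS gSs NH A₀ hA₀ hA₀').Hodot,
      ModelFrobenioid.baseMap σ.inv ≫ b = b ≫ (gS A.base hA h).hom := by
  obtain ⟨h, hh, hσh⟩ := Subgroup.mem_map.1 (inv_mem hσ)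
  obtain ⟨c, hc⟩ := hS hA hAN b
  have hbase : ModelFrobenioid.baseMap σ.inv = (gS AN.base hAN h).hom := (congrArg Iso.hom hσh).symm
  refine ⟨c * h * c⁻¹, (MonoidHom.normal_ker _).conj_mem h hh c, ?_⟩
  rw [hbase, hc h]

/-- **`H_{A_N}`-fixedness of `f|_{A_N}` from the `H_A`-fixedness of `f`** (Def. 4.1 (iii) «an element fixed by the
natural action of `H_A`», for the pull-back of birational units `((φ)^birat)^* = B(Base φ)` of the model): if `A`
is `H_⊙`-ample and `f ∈ O^×(A^birat)` is fixed by `H_A`, then for every `φ : A_N → A` from a Galois `A_N` the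
pull-back `B(Base φ) f` is fixed by `H_{A_N}` — `σ ∈ H_{A_N}` acts through `Base(σ⁻¹) ≫ Base(φ) = Base(φ) ≫ ρ_A(h′)`
(`exists_baseMap_inv_comp_eq_of_mem_HA`) and `ρ_A(h′)` lifts to `Aut_C(A)` by ampleness.
[cite: MochizukiEtTh2009, Def 4.1 (iii) p.313 (PDF p.87)] -/
theorem isFixedByHA_pullFracModel
    (hS : ∀ ⦃A B : D⦄ (hA : IG A) (hB : IG B) (b : B ⟶ A),
      ∃ c : X.Pi, ∀ g : X.Pi, (gS B hB g).hom ≫ b = b ≫ (gS A hA (c * g * c⁻¹)).hom)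
    {A AN : tf.category} (hamp : (mkOfModelCanonical X tf hZ hP IG gS gSs NH A₀ hA₀ hA₀').IsAmple A)
    {f : tf.biratUnitsModel A}
    (hfix : (mkOfModelCanonical X tf hZ hP IG gS gSs NH A₀ hA₀ hA₀').IsFixedByHA A hamp.isGalois f)
    (hAN : IG AN.base) (φ : AN ⟶ A) :
    (mkOfModelCanonical X tf hZ hP IG gS gSs NH A₀ hA₀ hA₀').IsFixedByHA AN hAN (tf.pullFracModel φ f) := by
  intro σ hσ
  obtain ⟨h', hh', hb⟩ := exists_baseMap_inv_comp_eq_of_mem_HA X tf hZ hP IG gS gSs NH A₀ hA₀ hA₀' hS hAN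
    hamp.isGalois (ModelFrobenioid.baseMap φ) hσ
  -- lift `ρ_A(h′) ∈ H_A^bs` to an automorphism `τ` of `A` (ampleness); `τ ∈ H_A` fixes `f`
  have hmem : gS A.base hamp.isGalois h' ∈
      (mkOfModelCanonical X tf hZ hP IG gS gSs NH A₀ hA₀ hA₀').HAbs A hamp.isGalois :=
    Subgroup.mem_map.2 ⟨h', hh', rfl⟩
  obtain ⟨τ, hτ⟩ := hamp.surj hmem
  have hτmem : τ ∈ (mkOfModelCanonical X tf hZ hP IG gS gSs NH A₀ hA₀ hA₀').HA A hamp.isGalois :=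
    Subgroup.mem_comap.2 (by rw [hτ]; exact hmem)
  have hτb : ModelFrobenioid.baseMap τ.hom = (gS A.base hamp.isGalois h').hom := congrArg Iso.hom hτ
  -- `τ⁻¹ ∈ H_A` fixes `f`: `B(Base τ) f = f` (the action of `τ⁻¹` on `O^×(A^birat) = B(A^bs)^×` is `B(Base τ)`)
  have hfixτ : (tf.ratFnFunctor.map (gS A.base hamp.isGalois h').hom.op).hom
      ((f : tf.biratUnitsModel A) : tf.ratFnFunctor.obj (op A.base)) = f := by
    rw [← hτb]
    exact congrArg (fun u : tf.biratUnitsModel A => (u : tf.ratFnFunctor.obj (op A.base))) (hfix τ⁻¹ (inv_mem hτmem))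
  apply Units.ext
  change ((tf.biratAutModel AN σ (tf.pullFracModel φ f) : tf.biratUnitsModel AN) : tf.ratFnFunctor.obj (op AN.base)) =
    ((tf.pullFracModel φ f : tf.biratUnitsModel AN) : tf.ratFnFunctor.obj (op AN.base))
  rw [TemperedFrobenioid.coe_biratAutModel_apply, TemperedFrobenioid.coe_pullFracModel_apply,
    ← CategoryTheory.comp_apply, ← Functor.map_comp, ← op_comp, hb, op_comp, Functor.map_comp,
    CategoryTheory.comp_apply, hfixτ]

include hΦd in
/-- **[EtTh] Prop. 4.2 (iii) OVER A GENERAL DOMAIN, with the root-carrying covering chosen at a multiple level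
`M` of `N`** (Rmk. 4.3.2 «[cf. Proposition 4.2, (iii)]» applied on the domain of a given root; Prop. 5.2 (i),
proof: «follows immediately from the definition of the field `J̈_{l·N}`») — at the canonical model, modulo the
base-level laws `hDSpull` ([FrdI] Prop. 4.1 (iii)), `hR` (ERRATUM E2 root law, G-w4d044-3), `hE₂` ([FrdII]
Rmk. 2.2.1 refinement at the two levels `N ∣ M` jointly — G-w4d044-2's shape twice) and `hS` (Def. 4.1 (ii)).
For a Frobenius-trivial `A` with Galois base, `A = A_⊙` whenever `A^bs ≅ A_⊙^bs`, `f ∈ O^×(A^birat)` fixed by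
`H_A` and a right fraction-pair `P` of `f`: there is an `N`-th root `R` of `P` (domain `A`) whose `N`-domain
`A_N` satisfies `A_N = A_⊙` whenever `A_N^bs ≅ A_⊙^bs`, is `μ_M`-saturated, and satisfies Def. 4.1 (iii)(a) at
level `M`.  [cite: MochizukiEtTh2009, Rmk 4.3.2 p.318–319 (PDF pp.92–93)] -/
theorem exists_nthRoot_twoLevel_mkOfModelCanonical
    (hDSpull : ∀ {A A' : D} (e : A' ⟶ A) {a b : tf.Φ.carrier (op A)},
      (∀ x : tf.Φ.carrier (op A), x ∣ a → x ∣ b → x = 1) →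
        ∀ y : tf.Φ.carrier (op A'), y ∣ pull tf.divisorMonoid e a → y ∣ pull tf.divisorMonoid e b → y = 1)
    (hR : ∀ (N : ℕ+) (A : D), IG A → ∀ f : tf.ratFnFunctor.obj (op A),
      ∃ (A' : D) (_ : IG A') (b : A' ⟶ A) (g : tf.ratFnFunctor.obj (op A')),
        g ^ (N : ℕ) = pull tf.ratFnFunctor b f)
    (hE₂ : ∀ (N M : ℕ+), (N : ℕ) ∣ (M : ℕ) → ∀ (A' : tf.category),
      PreFrobenioid.IsFrobeniusTrivial tf.toElem A' → IG A'.base →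
      ∃ (A'' : tf.category) (ψ : A'' ⟶ A'), PreFrobenioid.IsPullbackMorphism tf.toElem ψ ∧ IG A''.base ∧
        tf.IsMuSaturated A'' M ∧
          NH (mkOfModelCanonical X tf hZ hP IG gS gSs NH A₀ hA₀ hA₀').HodotBsFld A'' M ∧
            NH (mkOfModelCanonical X tf hZ hP IG gS gSs NH A₀ hA₀ hA₀').HodotBsFld A'' N)
    (hS : ∀ ⦃A B : D⦄ (hA : IG A) (hB : IG B) (b : B ⟶ A),
      ∃ c : X.Pi, ∀ g : X.Pi, (gS B hB g).hom ≫ b = b ≫ (gS A hA (c * g * c⁻¹)).hom)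
    {A B : tf.category} (hAft : PreFrobenioid.IsFrobeniusTrivial tf.toElem A) (hAG : IG A.base)
    (hskA : Nonempty (A.base ≅ A₀.base) → A = A₀) {f : tf.biratUnitsModel A}
    (hfix : (mkOfModelCanonical X tf hZ hP IG gS gSs NH A₀ hA₀ hA₀').IsFixedByHA A hAG f)
    (P : (mkOfModelCanonical X tf hZ hP IG gS gSs NH A₀ hA₀ hA₀').FractionPair f B)
    (N M : ℕ+) (hNM : (N : ℕ) ∣ (M : ℕ)) :
    ∃ R : (mkOfModelCanonical X tf hZ hP IG gS gSs NH A₀ hA₀ hA₀').NthRoot f P N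
        (fun {_} φ x => tf.pullFracModel φ x),
      (Nonempty (R.AN.base ≅ A₀.base) → R.AN = A₀) ∧ tf.IsMuSaturated R.AN M ∧
        ∃ (A' A'' : tf.category) (s₁ : A' ⟶ R.AN) (s₂ : A' ⟶ A''),
          (mkOfModelCanonical X tf hZ hP IG gS gSs NH A₀ hA₀ hA₀').IsPreStep s₁ ∧
            (mkOfModelCanonical X tf hZ hP IG gS gSs NH A₀ hA₀ hA₀').IsPreStep s₂ ∧
              (mkOfModelCanonical X tf hZ hP IG gS gSs NH A₀ hA₀ hA₀').IsFrobeniusTrivial A'' ∧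
                (mkOfModelCanonical X tf hZ hP IG gS gSs NH A₀ hA₀ hA₀').IsNHSaturatedBsFld
                  (mkOfModelCanonical X tf hZ hP IG gS gSs NH A₀ hA₀ hA₀').HodotBsFld A'' M := by
  have hBg := tf.isGroupLike_ratFnFunctor T.isUnit_BΛ
  -- Step 1 (L01a over `A`, ERRATUM E2): a root of `f` over a Galois base covering, on the pull-back object
  obtain ⟨A', hA', b, g, hg⟩ := hR N A.base hAG ((show tf.biratUnitsModel A from f) : tf.ratFnFunctor.obj (op A.base))
  obtain ⟨W, δ, g', hWb, hδ, hg'⟩ :=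
    (mkOfModelCanonical X tf hZ hP IG gS gSs NH A₀ hA₀ hA₀').exists_isPullback_over_baseHom hΦd hBg A b hg
  have hWft : PreFrobenioid.IsFrobeniusTrivial tf.toElem W :=
    (mkOfModelCanonical X tf hZ hP IG gS gSs NH A₀ hA₀ hA₀').isFrobeniusTrivial_of_isPullback hΦd hBg hδ hAft
  have hWG : IG W.base := by
    rw [hWb]
    exact hA'
  -- Step 2 ([FrdII] Rmk. 2.2.1 at the two levels): the `μ_M`-saturated, `(M, H_⊙)`- and `(N, H_⊙)`-saturated refinement
  obtain ⟨A'', ψ, hψ, hG'', hμM, hNHM, hNHN⟩ := hE₂ N M hNM W hWft hWG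
  have hft'' : PreFrobenioid.IsFrobeniusTrivial tf.toElem A'' :=
    (mkOfModelCanonical X tf hZ hP IG gS gSs NH A₀ hA₀ hA₀').isFrobeniusTrivial_of_isPullback hΦd hBg hψ hWft
  have hφ₁ : (mkOfModelCanonical X tf hZ hP IG gS gSs NH A₀ hA₀ hA₀').IsPullback (ψ ≫ δ) :=
    (mkOfModelCanonical X tf hZ hP IG gS gSs NH A₀ hA₀ hA₀').isPullback_comp hΦd hBg hψ hδ
  have hg'' : tf.pullFracModel ψ g' ^ (N : ℕ) = tf.pullFracModel (ψ ≫ δ) f :=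
    (mkOfModelCanonical X tf hZ hP IG gS gSs NH A₀ hA₀ hA₀').pullFracModel_pow_eq_of_comp ψ δ hg'
  -- Step 3: normalisation into the skeletons through `A_⊙` and through `A` ([FrdI] Thm. 5.1 (iii) base-triviality)
  have hid : (mkOfModelCanonical X tf hZ hP IG gS gSs NH A₀ hA₀ hA₀').IsPreStep (𝟙 A'') :=
    ⟨by change ModelFrobenioid.degFr (𝟙 A'') = 1; rfl, by
      change IsIso (ModelFrobenioid.baseMap (𝟙 A''))
      rw [ModelFrobenioid.baseMap_id]
      infer_instance⟩
  have transport : ∀ (E : tf.category) (σ : A'' ≅ E), PreFrobenioid.IsFrobeniusTrivial tf.toElem E → IG E.base →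
      (Nonempty (E.base ≅ A₀.base) → E = A₀) → (Nonempty (E.base ≅ A.base) → E = A) →
      ∃ (AN : tf.category) (φ : AN ⟶ A) (gN : tf.biratUnitsModel AN),
        (Nonempty (AN.base ≅ A₀.base) → AN = A₀) ∧ (Nonempty (AN.base ≅ A.base) → AN = A) ∧
        (mkOfModelCanonical X tf hZ hP IG gS gSs NH A₀ hA₀ hA₀').IsPullback φ ∧
        PreFrobenioid.IsFrobeniusTrivial tf.toElem AN ∧ IG AN.base ∧ tf.IsMuSaturated AN M ∧
        gN ^ (N : ℕ) = tf.pullFracModel φ f ∧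
        (∃ (A₁ A₂ : tf.category) (s₁ : A₁ ⟶ AN) (s₂ : A₁ ⟶ A₂),
          (mkOfModelCanonical X tf hZ hP IG gS gSs NH A₀ hA₀ hA₀').IsPreStep s₁ ∧
            (mkOfModelCanonical X tf hZ hP IG gS gSs NH A₀ hA₀ hA₀').IsPreStep s₂ ∧
              (mkOfModelCanonical X tf hZ hP IG gS gSs NH A₀ hA₀ hA₀').IsFrobeniusTrivial A₂ ∧
                (mkOfModelCanonical X tf hZ hP IG gS gSs NH A₀ hA₀ hA₀').IsNHSaturatedBsFld
                  (mkOfModelCanonical X tf hZ hP IG gS gSs NH A₀ hA₀ hA₀').HodotBsFld A₂ M) ∧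
        (∃ (A₁ A₂ : tf.category) (s₁ : A₁ ⟶ AN) (s₂ : A₁ ⟶ A₂),
          (mkOfModelCanonical X tf hZ hP IG gS gSs NH A₀ hA₀ hA₀').IsPreStep s₁ ∧
            (mkOfModelCanonical X tf hZ hP IG gS gSs NH A₀ hA₀ hA₀').IsPreStep s₂ ∧
              (mkOfModelCanonical X tf hZ hP IG gS gSs NH A₀ hA₀ hA₀').IsFrobeniusTrivial A₂ ∧
                (mkOfModelCanonical X tf hZ hP IG gS gSs NH A₀ hA₀ hA₀').IsNHSaturatedBsFld
                  (mkOfModelCanonical X tf hZ hP IG gS gSs NH A₀ hA₀ hA₀').HodotBsFld A₂ N) := by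
    intro E σ hEft hEG hE₀ hE₁
    refine ⟨E, σ.inv ≫ ψ ≫ δ, tf.pullFracModel σ.inv (tf.pullFracModel ψ g'), hE₀, hE₁, ?_, hEft, hEG, ?_, ?_,
      ?_, ?_⟩
    · exact PreFrobenioid.IsPullbackMorphism.comp _ (PreFrobenioid.isPullbackMorphism_of_isIso _ σ.inv) hφ₁
    · exact (mkOfModelCanonical X tf hZ hP IG gS gSs NH A₀ hA₀ hA₀').isMuSaturated_of_iso σ hμM
    · exact (mkOfModelCanonical X tf hZ hP IG gS gSs NH A₀ hA₀ hA₀').pullFracModel_pow_eq_of_comp σ.inv (ψ ≫ δ) hg''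
    · exact ⟨A'', A'', 𝟙 A'' ≫ σ.hom, 𝟙 A'', ModelFrobenioid.isPreStep_comp_of_isIso hid σ.hom, hid, hft'', hNHM⟩
    · exact ⟨A'', A'', 𝟙 A'' ≫ σ.hom, 𝟙 A'', ModelFrobenioid.isPreStep_comp_of_isIso hid σ.hom, hid, hft'', hNHN⟩
  have key : ∃ (AN : tf.category) (φ : AN ⟶ A) (gN : tf.biratUnitsModel AN),
      (Nonempty (AN.base ≅ A₀.base) → AN = A₀) ∧ (Nonempty (AN.base ≅ A.base) → AN = A) ∧
      (mkOfModelCanonical X tf hZ hP IG gS gSs NH A₀ hA₀ hA₀').IsPullback φ ∧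
      PreFrobenioid.IsFrobeniusTrivial tf.toElem AN ∧ IG AN.base ∧ tf.IsMuSaturated AN M ∧
      gN ^ (N : ℕ) = tf.pullFracModel φ f ∧
      (∃ (A₁ A₂ : tf.category) (s₁ : A₁ ⟶ AN) (s₂ : A₁ ⟶ A₂),
        (mkOfModelCanonical X tf hZ hP IG gS gSs NH A₀ hA₀ hA₀').IsPreStep s₁ ∧
          (mkOfModelCanonical X tf hZ hP IG gS gSs NH A₀ hA₀ hA₀').IsPreStep s₂ ∧
            (mkOfModelCanonical X tf hZ hP IG gS gSs NH A₀ hA₀ hA₀').IsFrobeniusTrivial A₂ ∧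
              (mkOfModelCanonical X tf hZ hP IG gS gSs NH A₀ hA₀ hA₀').IsNHSaturatedBsFld
                (mkOfModelCanonical X tf hZ hP IG gS gSs NH A₀ hA₀ hA₀').HodotBsFld A₂ M) ∧
      (∃ (A₁ A₂ : tf.category) (s₁ : A₁ ⟶ AN) (s₂ : A₁ ⟶ A₂),
        (mkOfModelCanonical X tf hZ hP IG gS gSs NH A₀ hA₀ hA₀').IsPreStep s₁ ∧
          (mkOfModelCanonical X tf hZ hP IG gS gSs NH A₀ hA₀ hA₀').IsPreStep s₂ ∧
            (mkOfModelCanonical X tf hZ hP IG gS gSs NH A₀ hA₀ hA₀').IsFrobeniusTrivial A₂ ∧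
              (mkOfModelCanonical X tf hZ hP IG gS gSs NH A₀ hA₀ hA₀').IsNHSaturatedBsFld
                (mkOfModelCanonical X tf hZ hP IG gS gSs NH A₀ hA₀ hA₀').HodotBsFld A₂ N) := by
    by_cases h₀ : Nonempty (A''.base ≅ A₀.base)
    · obtain ⟨e⟩ := h₀
      obtain ⟨σ, -⟩ := (mkOfModelCanonical X tf hZ hP IG gS gSs NH A₀ hA₀ hA₀').exists_iso_baseMap_eq_of_isFrobeniusTrivial
        hBg hft'' hA₀ e
      exact transport A₀ σ hA₀ hA₀' (fun _ => rfl) (fun ⟨e'⟩ => (hskA ⟨e'.symm⟩).symm)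
    · by_cases h₁ : Nonempty (A''.base ≅ A.base)
      · obtain ⟨e⟩ := h₁
        obtain ⟨σ, -⟩ := (mkOfModelCanonical X tf hZ hP IG gS gSs NH A₀ hA₀ hA₀').exists_iso_baseMap_eq_of_isFrobeniusTrivial
          hBg hft'' hAft e
        exact transport A σ hAft hAG hskA (fun _ => rfl)
      · exact transport A'' (Iso.refl A'') hft'' hG'' (fun h => (h₀ h).elim) (fun h => (h₁ h).elim)
  obtain ⟨AN, φ, gN, hsk₀, hsk₁, hφ, hft, hG, hμM', hgN, hcM, hcN⟩ := key
  -- Step 4: `(N, H_⊙, f|_{A_N})`-saturation of `A_N` (Def. 4.1 (iii)), built in `S` itself; `μ_N` from `μ_M`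
  have hamp : (mkOfModelCanonical X tf hZ hP IG gS gSs NH A₀ hA₀ hA₀').IsAmple AN :=
    (mkOfModelCanonical X tf hZ hP IG gS gSs NH A₀ hA₀ hA₀').isAmple_of_isFrobeniusTrivial hBg hft hG
  have hampA : (mkOfModelCanonical X tf hZ hP IG gS gSs NH A₀ hA₀ hA₀').IsAmple A :=
    (mkOfModelCanonical X tf hZ hP IG gS gSs NH A₀ hA₀ hA₀').isAmple_of_isFrobeniusTrivial hBg hAft hAG
  have hμN : tf.IsMuSaturated AN N := hμM'.of_dvd hNM
  -- Step 5 (L03′ in the instance with distinguished object `A`): the base-Frobenius-type lift of `φ` up to a unit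
  obtain ⟨s, hs, α, dA, hd, hiso, hdeg⟩ := Prop42Sub.baseFrobeniusLiftUpToUnit_mkOfModelCanonical X tf hZ hP IG gS
    gSs NH A hAft hAG hΦd N AN φ hsk₁ hφ hft hG hμN
  have hpf : tf.pullFracModel dA.α₁ f = tf.pullFracModel φ f := by
    have hb : ModelFrobenioid.baseMap s.hom = 𝟙 _ := hs.1
    have h0 : ModelFrobenioid.baseMap dA.α₁ = ModelFrobenioid.baseMap (s.hom ≫ φ) :=
      congrArg ModelFrobenioid.baseMap hd
    have h1 : ModelFrobenioid.baseMap dA.α₁ = ModelFrobenioid.baseMap φ := by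
      rw [h0, ModelFrobenioid.baseMap_comp, hb, Category.id_comp]
    exact DFunLike.congr_fun (tf.pullFracModel_eq_of_baseMap_eq h1) f
  have hgN' : gN ^ (N : ℕ) = tf.pullFracModel dA.α₁ f := by
    rw [hpf]
    exact hgN
  -- Step 6 (L02 there): the fraction-pair of the root; Step 7 (L04 there): the isometry `β` and the two squares
  have hrfp := rootFractionPair_mkOfModel tf hZ hP T.isUnit_BΛ _ IG gS gSs NH _ A hAft hAG hΦd
    (fun N h x hxa hxb => h x (dvd_pow hxa (PNat.ne_zero N)) (dvd_pow hxb (PNat.ne_zero N))) hDSpull f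
    (⟨P.num, P.den, P.isPreStep_num, P.isPreStep_den, P.base_eq, P.frac_eq, P.disjointSupports⟩ :
      (mkOfModelCanonical X tf hZ hP IG gS gSs NH A hAft hAG).FractionPair f B)
    N AN dA.α₁ gN dA.cond_d hgN'
  obtain ⟨BN, QA, hQn, hQd⟩ := hrfp
  obtain ⟨β, hβiso, hβdeg, hcn, hcd⟩ := rootSquares_mkOfModel tf hZ hP T.isUnit_BΛ _ IG gS gSs NH _ A hAft hAG f
    (⟨P.num, P.den, P.isPreStep_num, P.isPreStep_den, P.base_eq, P.frac_eq, P.disjointSupports⟩ :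
      (mkOfModelCanonical X tf hZ hP IG gS gSs NH A hAft hAG).FractionPair f B)
    N AN α dA gN BN QA hiso hdeg hgN' hQn hQd
  -- Step 8: assemble the `N`-th root in `S` (fraction-pair and base-Frobenius-type data carried field by field)
  refine ⟨{ AN := AN
            BN := BN
            α := α
            β := β
            root := gN
            pair := ⟨QA.num, QA.den, QA.isPreStep_num, QA.isPreStep_den, QA.base_eq, QA.frac_eq, QA.disjointSupports⟩
            comm_num := hcn
            comm_den := hcd
            isIsometry := ⟨hiso, hβiso, hdeg, hβdeg⟩
            αData := ⟨dA.G, dA.G_le, dA.α₂, dA.α₁, dA.fac, dA.isFrobeniusTrivial, dA.isGalois, dA.isMuSaturated,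
              dA.mapsIsomorphically, dA.cond_c, dA.cond_d, dA.cond_e⟩
            pow_root := hgN'
            isSaturated := ⟨hamp, isFixedByHA_pullFracModel X tf hZ hP IG gS gSs NH A₀ hA₀ hA₀' hS hampA hfix hG dA.α₁,
              hcN, gN, hgN'⟩ }, hsk₀, hμM', hcM⟩

end Canonical

end BiKummerSetting

end Literature.AnabelianGeometry.EtaleTheta

end
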